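import Mathlib.Analysis.Distribution.SchwartzSpace.Fourier
import Mathlib.Analysis.Calculus.MeanValue
import Mathlib.MeasureTheory.Measure.Haar.InnerProductSpace
import Literature.NumberTheory.LFunctions.RudnickSarnak
import HarnessLib

/-!
# Rudnick–Sarnak `n`-level correlations for `ζ`: decay of the test functions `f_Φ`

Sibling file of `Literature/NumberTheory/LFunctions/RudnickSarnak.lean` (toward
`Literature.NumberTheory.LFunctions.rudnick_sarnak_unrestricted`, Rudnick–Sarnak 1996, Theorem 3.2
for `ζ`, at every level; back end). For a smooth compactly supported `Φ` on `ℝ^{k+1}` the test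
function `f_Φ` of (3.6) (`rsPhiTest Φ`) is `f_Φ(x) = Ψ(x_1 − x_0, …, x_k − x_0)` with
`Ψ = Ψ_Φ` the Fourier transform, along the hyperplane `Σ ξ_j = 0`, of the slice profile
`η ↦ Φ(−Ση, η)` — a Schwartz function (Rudnick–Sarnak 1996, p. 303: "since `Φ` has compact
support, `f` is … rapidly decreasing on `ℝⁿ` modulo the diagonal"). This file records the
quantitative consequences used in the unsmoothing and renormalisation steps:

* `RudnickSarnakN.Unsmooth.rsPhiTest_eq_psiFn` — `f_Φ(x) = Ψ(x_{·+1} − x_0)`;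
* `RudnickSarnakN.Unsmooth.exists_norm_psiFn_le_prod` — product decay
  `‖Ψ(y)‖ ≤ C_a Π_i (1 + |y_i|)^{-a}` for every `a`;
* `RudnickSarnakN.Unsmooth.exists_norm_psiFn_le_sup` — `‖Ψ(y)‖ ≤ C_a (1 + ‖y‖)^{-a}`;
* `RudnickSarnakN.Unsmooth.exists_norm_psiFn_sub_le` — the renormalisation estimate: if
  `|y'_i − y_i| ≤ τ |y_i|` for all `i` with `τ ≤ 1/2`, then
  `‖Ψ(y') − Ψ(y)‖ ≤ C τ Π_i (1 + |y_i|)^{-3}` (mean value inequality along the segment and decay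
  of `DΨ`).

All of this is Mathlib's Schwartz-space theory transported from `EuclideanSpace ℝ (Fin k)`.

## References

* Z. Rudnick, P. Sarnak, *Zeros of principal `L`-functions and random matrix theory*, Duke Math.
  J. 81 (1996), 269–322, (3.6) and p. 303.
-/

noncomputable section

open Complex Filter Set MeasureTheory Finset SchwartzMap
open scoped Real Topology FourierTransform RealInnerProductSpace ContDiff

namespace Literature.NumberTheory.LFunctions

namespace RudnickSarnakN

namespace Unsmooth

variable {k : ℕ}

/-! ## The slice profile and `Ψ_Φ` -/

/-- The slice profile `η ↦ Φ(−Ση, η)` of `Φ` on the hyperplane `Σ ξ_j = 0`. [cite: RudnickSarnak1996, (3.6)] -/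
def sliceFn (Φ : (Fin (k + 1) → ℝ) → ℂ) (η : Fin k → ℝ) : ℂ :=
  Φ (Fin.cons (-∑ i, η i) η)

/-- `Ψ_Φ(y) = f_Φ(0, y) = ∫ Φ(−Ση, η) e(−y·η) dη`. [cite: RudnickSarnak1996, (3.6)] -/
def psiFn (Φ : (Fin (k + 1) → ℝ) → ℂ) (y : Fin k → ℝ) : ℂ :=
  rsPhiTest Φ (Fin.cons 0 y)

/-- `Ψ_Φ` as an explicit integral. [cite: RudnickSarnak1996, (3.6)] -/
theorem psiFn_eq_integral (Φ : (Fin (k + 1) → ℝ) → ℂ) (y : Fin k → ℝ) :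
    psiFn Φ y = ∫ η : Fin k → ℝ, sliceFn Φ η * cexp (-(2 * π * I * ∑ i, (η i * y i : ℝ))) := by
  unfold psiFn rsPhiTest sliceFn
  congr 1 with η
  congr 2
  simp [mul_comm]

/-- **`f_Φ(x) = Ψ_Φ(x_1 − x_0, …, x_k − x_0)`** (diagonal invariance, TF 2). [cite: RudnickSarnak1996, (3.6)] -/
theorem rsPhiTest_eq_psiFn (Φ : (Fin (k + 1) → ℝ) → ℂ) (x : Fin (k + 1) → ℝ) :
    rsPhiTest Φ x = psiFn Φ fun i ↦ x i.succ - x 0 := by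
  unfold psiFn rsPhiTest
  congr 1 with η
  congr 2
  simp

/-- The slice profile of a smooth `Φ` is smooth. [folklore] -/
theorem contDiff_sliceFn {Φ : (Fin (k + 1) → ℝ) → ℂ} (hΦ : ContDiff ℝ ∞ Φ) : ContDiff ℝ ∞ (sliceFn Φ) := by
  unfold sliceFn
  refine hΦ.comp ?_
  refine contDiff_pi.2 fun j ↦ ?_
  refine Fin.cases ?_ (fun i ↦ ?_) j
  · simp only [Fin.cons_zero]
    exact (ContDiff.sum fun i (_ : i ∈ (Finset.univ : Finset (Fin k))) ↦ contDiff_apply ℝ ℝ i).neg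
  · simp only [Fin.cons_succ]
    exact contDiff_apply ℝ ℝ i

/-- The slice profile of a compactly supported `Φ` is compactly supported (`‖η‖ ≤ ‖(−Ση, η)‖`).
[folklore] -/
theorem hasCompactSupport_sliceFn {Φ : (Fin (k + 1) → ℝ) → ℂ} (hΦ : HasCompactSupport Φ) :
    HasCompactSupport (sliceFn Φ) := by
  obtain ⟨R, hR⟩ := hΦ.isCompact.isBounded.subset_closedBall 0
  refine HasCompactSupport.of_support_subset_isCompact (isCompact_closedBall (0 : Fin k → ℝ) R) ?_
  intro η hη
  rw [Function.mem_support] at hη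
  have hmem : (Fin.cons (-∑ i, η i) η : Fin (k + 1) → ℝ) ∈ Metric.closedBall 0 R :=
    hR (subset_tsupport _ (Function.mem_support.2 hη))
  rw [Metric.mem_closedBall, dist_zero_right] at hmem ⊢
  refine le_trans ?_ hmem
  refine (pi_norm_le_iff_of_nonneg (norm_nonneg _)).2 fun i ↦ ?_
  have := norm_le_pi_norm (Fin.cons (-∑ i, η i) η : Fin (k + 1) → ℝ) i.succ
  simpa using this

/-! ## Transport to Euclidean space -/

/-- The slice profile as a Schwartz function on `Fin k → ℝ`. [folklore] -/
def sliceS {Φ : (Fin (k + 1) → ℝ) → ℂ} (hd : ContDiff ℝ ∞ Φ) (hs : HasCompactSupport Φ) : 𝓢(Fin k → ℝ, ℂ) :=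
  (hasCompactSupport_sliceFn hs).toSchwartzMap (contDiff_sliceFn hd)

/-- The identification `EuclideanSpace ℝ (Fin k) ≃ (Fin k → ℝ)`. [folklore] -/
def eucl (k : ℕ) : EuclideanSpace ℝ (Fin k) ≃L[ℝ] (Fin k → ℝ) :=
  PiLp.continuousLinearEquiv 2 ℝ (fun _ : Fin k ↦ ℝ)

/-- The slice profile on Euclidean space. [folklore] -/
def sliceE {Φ : (Fin (k + 1) → ℝ) → ℂ} (hd : ContDiff ℝ ∞ Φ) (hs : HasCompactSupport Φ) :
    𝓢(EuclideanSpace ℝ (Fin k), ℂ) :=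
  SchwartzMap.compCLMOfContinuousLinearEquiv ℂ (eucl k) (sliceS hd hs)

/-- `Ψ_Φ` as a Schwartz function on Euclidean space: the Fourier transform of the slice profile.
[folklore] -/
def psiE {Φ : (Fin (k + 1) → ℝ) → ℂ} (hd : ContDiff ℝ ∞ Φ) (hs : HasCompactSupport Φ) :
    𝓢(EuclideanSpace ℝ (Fin k), ℂ) :=
  𝓕 (sliceE hd hs)

/-- `sliceE` evaluated. [folklore] -/
theorem sliceE_apply {Φ : (Fin (k + 1) → ℝ) → ℂ} (hd : ContDiff ℝ ∞ Φ) (hs : HasCompactSupport Φ)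
    (v : EuclideanSpace ℝ (Fin k)) : sliceE hd hs v = sliceFn Φ (WithLp.ofLp v) := rfl

/-- Transport of Mathlib's Fourier transform on `EuclideanSpace ℝ (Fin k)` to the explicit
integral on `Fin k → ℝ`. [folklore] -/
theorem fourier_eucl_toLp (F : (Fin k → ℝ) → ℂ) (w : Fin k → ℝ) :
    𝓕 (fun v : EuclideanSpace ℝ (Fin k) ↦ F (WithLp.ofLp v)) (WithLp.toLp 2 w) =
      ∫ η : Fin k → ℝ, F η * cexp (-(2 * π * I * ∑ i, (η i * w i : ℝ))) := by
  rw [Real.fourier_eq']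
  rw [← (PiLp.volume_preserving_toLp (Fin k)).integral_comp
    (MeasurableEquiv.toLp 2 (Fin k → ℝ)).measurableEmbedding]
  congr 1
  funext η
  simp only [smul_eq_mul]
  rw [mul_comm]
  congr 1
  have hinner : ⟪WithLp.toLp 2 η, WithLp.toLp 2 w⟫ = ∑ i, η i * w i := by
    rw [EuclideanSpace.inner_toLp_toLp]
    simp [dotProduct, mul_comm]
  rw [hinner]
  push_cast
  ring_nf

/-- **`Ψ_Φ(y) = psiE(y)`**. [folklore] -/
theorem psiFn_eq_psiE {Φ : (Fin (k + 1) → ℝ) → ℂ} (hd : ContDiff ℝ ∞ Φ) (hs : HasCompactSupport Φ)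
    (y : Fin k → ℝ) : psiFn Φ y = psiE hd hs (WithLp.toLp 2 y) := by
  rw [psiFn_eq_integral]
  unfold psiE
  rw [SchwartzMap.fourier_coe]
  have : ((sliceE hd hs : 𝓢(EuclideanSpace ℝ (Fin k), ℂ)) : EuclideanSpace ℝ (Fin k) → ℂ) =
      fun v ↦ sliceFn Φ (WithLp.ofLp v) := rfl
  rw [this, fourier_eucl_toLp]

/-! ## Decay -/

/-- Coordinates are bounded by the Euclidean norm: `|y_i| ≤ ‖toLp 2 y‖`. [folklore] -/
theorem abs_apply_le_norm_toLp (y : Fin k → ℝ) (i : Fin k) : |y i| ≤ ‖(WithLp.toLp 2 y : EuclideanSpace ℝ (Fin k))‖ := by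
  have h := PiLp.norm_apply_le (WithLp.toLp 2 y : EuclideanSpace ℝ (Fin k)) i
  simpa [Real.norm_eq_abs] using h

/-- The sup norm is bounded by the Euclidean norm: `‖y‖ ≤ ‖toLp 2 y‖`. [folklore] -/
theorem norm_le_norm_toLp (y : Fin k → ℝ) : ‖y‖ ≤ ‖(WithLp.toLp 2 y : EuclideanSpace ℝ (Fin k))‖ :=
  (pi_norm_le_iff_of_nonneg (norm_nonneg _)).2 fun i ↦ by
    rw [Real.norm_eq_abs]; exact abs_apply_le_norm_toLp y i

/-- `Π_i (1 + |y_i|)^a ≤ (1 + ‖toLp 2 y‖)^{a k}`. [folklore] -/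
theorem prod_one_add_abs_pow_le (y : Fin k → ℝ) (a : ℕ) :
    ∏ i, (1 + |y i|) ^ a ≤ (1 + ‖(WithLp.toLp 2 y : EuclideanSpace ℝ (Fin k))‖) ^ (a * k) := by
  calc ∏ i, (1 + |y i|) ^ a ≤ ∏ _i : Fin k, (1 + ‖(WithLp.toLp 2 y : EuclideanSpace ℝ (Fin k))‖) ^ a :=
        Finset.prod_le_prod (fun i _ ↦ by positivity) fun i _ ↦
          pow_le_pow_left₀ (by positivity) (by linarith [abs_apply_le_norm_toLp y i]) _
    _ = (1 + ‖(WithLp.toLp 2 y : EuclideanSpace ℝ (Fin k))‖) ^ (a * k) := by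
        rw [Finset.prod_const, Finset.card_univ, Fintype.card_fin, ← pow_mul]

/-- **Product decay of `Ψ_Φ`**: for every `a` there is `C ≥ 0` with
`‖Ψ_Φ(y)‖ ≤ C Π_i (1 + |y_i|)^{-a}`. [cite: RudnickSarnak1996, p. 303] -/
theorem exists_norm_psiFn_le_prod {Φ : (Fin (k + 1) → ℝ) → ℂ} (hd : ContDiff ℝ ∞ Φ) (hs : HasCompactSupport Φ)
    (a : ℕ) : ∃ C : ℝ, 0 ≤ C ∧ ∀ y : Fin k → ℝ, ‖psiFn Φ y‖ ≤ C * ∏ i, ((1 + |y i|) ^ a)⁻¹ := by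
  set g := psiE hd hs
  set D : ℝ := 2 ^ (a * k) * (Finset.Iic (a * k, 0)).sup (fun m ↦ SchwartzMap.seminorm ℝ m.1 m.2) g
  have hD0 : 0 ≤ D := by positivity
  refine ⟨D, hD0, fun y ↦ ?_⟩
  have h := SchwartzMap.one_add_le_sup_seminorm_apply (𝕜 := ℝ) (m := (a * k, 0)) (k := a * k) (n := 0)
    le_rfl le_rfl g (WithLp.toLp 2 y)
  rw [norm_iteratedFDeriv_zero] at h
  rw [psiFn_eq_psiE hd hs]
  have hP : 0 < ∏ i, (1 + |y i|) ^ a := Finset.prod_pos fun i _ ↦ by positivity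
  have hprod := prod_one_add_abs_pow_le y a
  rw [Finset.prod_inv_distrib, ← div_eq_mul_inv, le_div_iff₀ hP]
  calc ‖g (WithLp.toLp 2 y)‖ * ∏ i, (1 + |y i|) ^ a
      ≤ ‖g (WithLp.toLp 2 y)‖ * (1 + ‖(WithLp.toLp 2 y : EuclideanSpace ℝ (Fin k))‖) ^ (a * k) :=
        mul_le_mul_of_nonneg_left hprod (norm_nonneg _)
    _ ≤ D := by rw [mul_comm]; exact h

/-- **Sup-norm decay of `Ψ_Φ`**: for every `a` there is `C ≥ 0` with `‖Ψ_Φ(y)‖ ≤ C (1 + ‖y‖)^{-a}`.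
[cite: RudnickSarnak1996, p. 303] -/
theorem exists_norm_psiFn_le_sup {Φ : (Fin (k + 1) → ℝ) → ℂ} (hd : ContDiff ℝ ∞ Φ) (hs : HasCompactSupport Φ)
    (a : ℕ) : ∃ C : ℝ, 0 ≤ C ∧ ∀ y : Fin k → ℝ, ‖psiFn Φ y‖ ≤ C * ((1 + ‖y‖) ^ a)⁻¹ := by
  set g := psiE hd hs
  set D : ℝ := 2 ^ a * (Finset.Iic (a, 0)).sup (fun m ↦ SchwartzMap.seminorm ℝ m.1 m.2) g
  have hD0 : 0 ≤ D := by positivity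
  refine ⟨D, hD0, fun y ↦ ?_⟩
  have h := SchwartzMap.one_add_le_sup_seminorm_apply (𝕜 := ℝ) (m := (a, 0)) (k := a) (n := 0)
    le_rfl le_rfl g (WithLp.toLp 2 y)
  rw [norm_iteratedFDeriv_zero] at h
  rw [psiFn_eq_psiE hd hs]
  have hP : 0 < (1 + ‖y‖) ^ a := by positivity
  rw [← div_eq_mul_inv, le_div_iff₀ hP]
  calc ‖g (WithLp.toLp 2 y)‖ * (1 + ‖y‖) ^ a
      ≤ ‖g (WithLp.toLp 2 y)‖ * (1 + ‖(WithLp.toLp 2 y : EuclideanSpace ℝ (Fin k))‖) ^ a :=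
        mul_le_mul_of_nonneg_left (pow_le_pow_left₀ (by positivity) (by linarith [norm_le_norm_toLp y]) _) (norm_nonneg _)
    _ ≤ D := by rw [mul_comm]; exact h

/-- `Ψ_Φ` is bounded. [folklore] -/
theorem exists_norm_psiFn_le {Φ : (Fin (k + 1) → ℝ) → ℂ} (hd : ContDiff ℝ ∞ Φ) (hs : HasCompactSupport Φ) :
    ∃ C : ℝ, 0 ≤ C ∧ ∀ y : Fin k → ℝ, ‖psiFn Φ y‖ ≤ C := by
  obtain ⟨C, hC0, hC⟩ := exists_norm_psiFn_le_sup hd hs 0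
  exact ⟨C, hC0, fun y ↦ (hC y).trans (by simp)⟩

/-! ## The renormalisation estimate -/

/-- Decay of the derivative: `‖DΨ(v)‖ (1 + ‖v‖)^b ≤ D_b`. [folklore] -/
theorem exists_norm_fderiv_psiE_le {Φ : (Fin (k + 1) → ℝ) → ℂ} (hd : ContDiff ℝ ∞ Φ) (hs : HasCompactSupport Φ)
    (b : ℕ) : ∃ D : ℝ, 0 ≤ D ∧ ∀ v : EuclideanSpace ℝ (Fin k),
      (1 + ‖v‖) ^ b * ‖fderiv ℝ (psiE hd hs) v‖ ≤ D := by
  set g := psiE hd hs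
  refine ⟨2 ^ b * (Finset.Iic (b, 1)).sup (fun m ↦ SchwartzMap.seminorm ℝ m.1 m.2) g, by positivity, fun v ↦ ?_⟩
  have h := SchwartzMap.one_add_le_sup_seminorm_apply (𝕜 := ℝ) (m := (b, 1)) (k := b) (n := 1)
    le_rfl le_rfl g v
  rwa [norm_iteratedFDeriv_one] at h

/-- `Σ_i |y_i| ≤ Π_i (1 + |y_i|)`. [folklore] -/
theorem sum_abs_le_prod_one_add (y : Fin k → ℝ) : ∑ i, |y i| ≤ ∏ i, (1 + |y i|) := by
  have key : ∀ s : Finset (Fin k), ∑ i ∈ s, |y i| ≤ ∏ i ∈ s, (1 + |y i|) := by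
    intro s
    induction s using Finset.induction_on with
    | empty => simp
    | insert j s hj ih =>
      rw [Finset.sum_insert hj, Finset.prod_insert hj]
      have h1 : 1 ≤ ∏ i ∈ s, (1 + |y i|) := by
        calc (1 : ℝ) = ∏ _i ∈ s, (1 : ℝ) := Finset.prod_const_one.symm
          _ ≤ ∏ i ∈ s, (1 + |y i|) :=
              Finset.prod_le_prod (fun _ _ ↦ zero_le_one) fun i _ ↦ by linarith [abs_nonneg (y i)]
      have h0 : 0 ≤ ∑ i ∈ s, |y i| := Finset.sum_nonneg fun i _ ↦ abs_nonneg _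
      nlinarith [abs_nonneg (y j)]
  exact key Finset.univ

/-- **The renormalisation estimate for `Ψ_Φ`.** There is `C ≥ 0` such that whenever
`|y'_i − y_i| ≤ τ |y_i|` for all `i`, with `0 ≤ τ ≤ 1/2`, then
`‖Ψ_Φ(y') − Ψ_Φ(y)‖ ≤ C τ Π_i (1 + |y_i|)^{-3}`: along the segment from `y` to `y'` every
coordinate keeps modulus `≥ |y_i|/2`, so `‖DΨ‖ ≤ D (1 + ‖·‖)^{-4k} ≤ D 2^{4k} Π (1 + |y_i|)^{-4}`
there, while `‖y' − y‖ ≤ τ Σ |y_i| ≤ τ Π (1 + |y_i|)`. (Rudnick–Sarnak 1996, (3.77): the mean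
value theorem in the passage `(L/2π)γ ↦ γ̃`.) [cite: RudnickSarnak1996, (3.77)] -/
theorem exists_norm_psiFn_sub_le {Φ : (Fin (k + 1) → ℝ) → ℂ} (hd : ContDiff ℝ ∞ Φ) (hs : HasCompactSupport Φ) :
    ∃ C : ℝ, 0 ≤ C ∧ ∀ (τ : ℝ), 0 ≤ τ → τ ≤ 1 / 2 → ∀ y y' : Fin k → ℝ,
      (∀ i, |y' i - y i| ≤ τ * |y i|) →
        ‖psiFn Φ y' - psiFn Φ y‖ ≤ C * τ * ∏ i, ((1 + |y i|) ^ 3)⁻¹ := by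
  obtain ⟨D, hD0, hD⟩ := exists_norm_fderiv_psiE_le hd hs (4 * k)
  set g := psiE hd hs
  refine ⟨D * 2 ^ (4 * k), by positivity, fun τ hτ0 hτ y y' hyy' ↦ ?_⟩
  set v : EuclideanSpace ℝ (Fin k) := WithLp.toLp 2 y
  set v' : EuclideanSpace ℝ (Fin k) := WithLp.toLp 2 y'
  set P : ℝ := ∏ i, (1 + |y i|)
  have hP1 : ∀ i, (1 : ℝ) ≤ 1 + |y i| := fun i ↦ by linarith [abs_nonneg (y i)]
  have hP0 : 0 < P := Finset.prod_pos fun i _ ↦ by linarith [hP1 i]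
  -- the derivative bound on the segment
  set K : ℝ := D * 2 ^ (4 * k) * (P ^ 4)⁻¹
  have hK0 : 0 ≤ K := by positivity
  have hseg : ∀ x ∈ segment ℝ v v', ‖fderiv ℝ g x‖ ≤ K := by
    rintro _ ⟨a, b, ha, hb, hab, rfl⟩
    set x : EuclideanSpace ℝ (Fin k) := a • v + b • v' with hxdef
    -- coordinates of the point of the segment
    have hcoord : ∀ i, |y i| / 2 ≤ |x i| := by
      intro i
      have hx : x i = y i + b * (y' i - y i) := by
        simp only [hxdef, v, v', PiLp.add_apply, PiLp.smul_apply, smul_eq_mul]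
        have : a = 1 - b := by linarith
        rw [this]
        ring
      rw [hx]
      have h1 : |b * (y' i - y i)| ≤ |y i| / 2 := by
        rw [abs_mul, abs_of_nonneg hb]
        have hb1 : b ≤ 1 := by linarith
        calc b * |y' i - y i| ≤ 1 * (τ * |y i|) :=
              mul_le_mul hb1 (hyy' i) (abs_nonneg _) zero_le_one
          _ ≤ |y i| / 2 := by rw [one_mul]; nlinarith [abs_nonneg (y i)]
      have := abs_sub_abs_le_abs_sub (y i) (-(b * (y' i - y i)))
      rw [abs_neg, sub_neg_eq_add] at this
      linarith
    -- `(1 + ‖x‖)^{4k} ≥ 2^{-4k} P^4`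
    have hnorm : ∀ i, |x i| ≤ ‖x‖ := fun i ↦ by
      have h := PiLp.norm_apply_le x i
      rwa [Real.norm_eq_abs] at h
    have hlow : P ^ 4 ≤ 2 ^ (4 * k) * (1 + ‖x‖) ^ (4 * k) := by
      have h1 : ∀ i, 1 + |y i| ≤ 2 * (1 + ‖x‖) := fun i ↦ by
        linarith [hcoord i, hnorm i, norm_nonneg x]
      calc P ^ 4 = ∏ i, (1 + |y i|) ^ 4 := by rw [Finset.prod_pow]
        _ ≤ ∏ _i : Fin k, (2 * (1 + ‖x‖)) ^ 4 :=
            Finset.prod_le_prod (fun i _ ↦ by positivity) fun i _ ↦ pow_le_pow_left₀ (by positivity) (h1 i) 4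
        _ = 2 ^ (4 * k) * (1 + ‖x‖) ^ (4 * k) := by
            rw [Finset.prod_const, Finset.card_univ, Fintype.card_fin, ← pow_mul, mul_pow, mul_comm 4 k]
    have hx := hD x
    have hpos : 0 < (1 + ‖x‖) ^ (4 * k) := by positivity
    -- conclude
    have h1 : ‖fderiv ℝ g x‖ ≤ D * ((1 + ‖x‖) ^ (4 * k))⁻¹ := by
      rw [← div_eq_mul_inv, le_div_iff₀ hpos, mul_comm]; exact hx
    have hinv : ((1 + ‖x‖) ^ (4 * k))⁻¹ ≤ 2 ^ (4 * k) * (P ^ 4)⁻¹ := by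
      rw [← div_eq_mul_inv, le_div_iff₀ (pow_pos hP0 4), inv_mul_le_iff₀ hpos]
      calc P ^ 4 ≤ 2 ^ (4 * k) * (1 + ‖x‖) ^ (4 * k) := hlow
        _ = (1 + ‖x‖) ^ (4 * k) * 2 ^ (4 * k) := mul_comm _ _
    refine h1.trans ?_
    simp only [K]
    rw [mul_assoc]
    exact mul_le_mul_of_nonneg_left hinv hD0
  -- mean value inequality
  have hMV := (convex_segment v v').norm_image_sub_le_of_norm_fderiv_le (𝕜 := ℝ) (f := g)
    (fun x _ ↦ g.differentiableAt) hseg (left_mem_segment ℝ v v') (right_mem_segment ℝ v v')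
  rw [psiFn_eq_psiE hd hs y', psiFn_eq_psiE hd hs y]
  refine hMV.trans ?_
  -- `‖v' − v‖ ≤ τ Σ|y_i| ≤ τ P`
  have hdist : ‖v' - v‖ ≤ τ * P := by
    have h1 : ‖v' - v‖ ≤ ∑ i, |y' i - y i| := by
      have : v' - v = WithLp.toLp 2 (y' - y) := by simp [v, v', WithLp.toLp_sub]
      rw [this, EuclideanSpace.norm_eq]
      refine Real.sqrt_le_iff.2 ⟨Finset.sum_nonneg fun i _ ↦ abs_nonneg _, ?_⟩
      have hsq : ∑ i, ‖(y' - y) i‖ ^ 2 = ∑ i, |y' i - y i| ^ 2 := by simp [Real.norm_eq_abs]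
      rw [hsq]
      exact Finset.sum_sq_le_sq_sum_of_nonneg fun i _ ↦ abs_nonneg _
    have h2 : ∑ i, |y' i - y i| ≤ τ * ∑ i, |y i| := by
      rw [Finset.mul_sum]; exact Finset.sum_le_sum fun i _ ↦ hyy' i
    exact h1.trans (h2.trans (mul_le_mul_of_nonneg_left (sum_abs_le_prod_one_add y) hτ0))
  have hprodinv : ∏ i, ((1 + |y i|) ^ 3)⁻¹ = (P ^ 3)⁻¹ := by
    rw [Finset.prod_inv_distrib, Finset.prod_pow]
  rw [hprodinv]
  calc K * ‖v' - v‖ ≤ K * (τ * P) := mul_le_mul_of_nonneg_left hdist hK0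
    _ = D * 2 ^ (4 * k) * τ * (P ^ 3)⁻¹ := by
        simp only [K]; field_simp

end Unsmooth

end RudnickSarnakN

end Literature.NumberTheory.LFunctions

end
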